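import Literature.Computability.Cryptography.OracleAdversaryCoinPrefix
import Literature.Computability.Cryptography.HybridSampling
import Literature.Computability.Complexity.LengthCompare
import Literature.Computability.Complexity.FPStringBricks
import Literature.Computability.Complexity.FoldBricks
import Literature.Computability.Complexity.BitCodecs
import Literature.Computability.Complexity.TM2PassThrough
import HarnessLib

/-!
# Stretching a one-bit generator relative to an oracle: the hybrid reduction of Goldreich's Thm. 3.3.3, uniform, exact, with a public context

Goldreich, *Foundations of Cryptography I* (CUP 2001), Construction 3.3.2 / Thm. 3.3.3 (PDF pp. 146–148;
= Håstad–Impagliazzo–Levin–Luby 1999, Prop. 3.3.4): from `G₁ : {0,1}^d → {0,1}^{d+1}` the iterated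
generator `G(s) = σ₁ ⋯ σ_T` (`σᵢ` the first bit of `G₁(s_{i−1})`, `sᵢ` its suffix), and the reduction
"`D'` selects `k` uniformly in `{0, …, T−1}`, `β ← U_k`, and outputs `D(β · first(α) · G_{T−k−1}(suffix(α)))`",
whose distinguishing gap between `α ← G₁(U_d)` and `α ← U_{d+1}` is EXACTLY `(Pr[D(U_T)=1] − Pr[D(G(U_d))=1])/T`
(the hybrids `H^k = U_k · G_{T−k}(U_d)` telescope). The tree proves this for `RandAlg` distinguishers
without oracle and packages it asymptotically (`PRGStretchExtensionReduction.lean`, `isPRG_stretchGen`;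
`MildlyNonuniformPRG.lean`, `AdvStretch`, with an advice). This file gives the form needed by
RELATIVISED, PER-LENGTH security reductions with a PUBLIC CONTEXT (HILL's "public input", ABK⁺06's
parameter `y`): the one-step family and the distinguishers read a context string `c` next to their
argument, the distinguishers are PPT ORACLE adversaries (`OracleGames.lean`) with an arbitrary
deterministic oracle, and the conclusion is an exact identity at every seed length `d` and every `c`.

* `OStretch.os G₁ c t` — the one-step family `t ↦ G₁ ⟨c, t⟩` normalised (padded/truncated) to output
  length `|t| + 1` on EVERY string (transparent where `G₁` already has that length, `os_eq_of_length`),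
  so that Construction 3.3.2 and its machine apply unconditionally; `OStretch.gen2 G₁ ⟨c, s⟩ =
  σ₁ ⋯ σ_{2|s|}` — the LENGTH-DOUBLING iterate (`PRGStretch.gen (os G₁ c) (2|s|) s`), an `FP` program
  (`gen2_mem_FP`, a clocked loop carrying the context, as in `AdvStretch`);
* `OStretch.pre G₁` — the preprocessing of `D'` as ONE polynomial-time string map of
  `⟨⟨c, α⟩, coins⟩`: with `d = |α| − 1`, `T = 2d`, `κ = |bin T|`, it reads `k = ⟦first κ coins⟧`; if
  `k < T` it assembles `⟨c, β · first(α) · gen_{T−k−1}(suffix(α))⟩` with `β` the next `k` coins, and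
  otherwise the `α`-independent dummy `⟨c, next T coins⟩` (`pre_boolPair`, `word`); the reduction
  `D' = M₁` is `M₂` after this RANDOMISED preprocessing (`OracleAdversary.exists_ppt_outputPMF_rprecomp`,
  `OracleAdversaryCoinPrefix.lean`), a PPT oracle adversary forwarding `M₂`'s oracle queries;
* **`OStretch.exists_oneStep_distinguisher`** — for every PPT oracle adversary `M₂` there is a PPT
  oracle adversary `M₁` such that for EVERY oracle `O`, context `c` and seed length `d`:
  `Pr_{α←U_{d+1}}[M₁^O⟨c,α⟩=1] − Pr_{t←U_d}[M₁^O⟨c, os G₁ c t⟩=1]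
     = (Pr_{w←U_{2d}}[M₂^O⟨c,w⟩=1] − Pr_{s←U_d}[M₂^O⟨c, gen2 G₁ ⟨c,s⟩⟩=1]) / 2^κ`, `κ = |bin(2d)|`
  (`2^κ ≤ 4d + 1`, `two_pow_kap_le`): Claims 3.3.3.1–2 computed as uniform averages
  (`uniformAvg`), the dummy branch cancelling, the sum over `k < T` telescoping.

No asymptotics, no negligible functions: the consumer (the `MCSP` universal-inverter reduction,
`MetaComplexity/MCSPUniversalInverterAdvice.lean`) needs the identity at each length with the loss
`2^κ = O(d)` explicit.

## References

* O. Goldreich, *Foundations of Cryptography I*, CUP 2001: Construction 3.3.2, Thm. 3.3.3 and its proof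
  (hybrids `H^k_n`, Claims 3.3.3.1–3.3.3.2, algorithm `D'`), PDF pp. 146–148; §3.6 Def. 3.6.4 (PPT
  oracle machines).
* J. Håstad, R. Impagliazzo, L. A. Levin, M. Luby, SIAM J. Comput. 28 (1999): Prop. 3.3.4 (stretching),
  §3.1 (public input), Def. 3.6.1 (oracle-machine reductions, level-wise).
* E. Allender, H. Buhrman, M. Koucký, D. van Melkebeek, D. Ronneburger, SIAM J. Comput. 35 (2006),
  §4.1 (`G^{HILL}_f : {0,1}ⁿ → {0,1}^{2n}`, relativised distinguishers `M^L(y, ·)`).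
-/

noncomputable section

namespace Literature.Computability.Cryptography

open _root_.Computability Complexity Complexity.Brick PRGStretch PRGTrunc Polynomial Finset

namespace OStretch

variable (G₁ : List Bool → List Bool)

/-! ### Small list facts -/

/-- `|1ⁿ| = n`. [folklore] -/
private theorem length_ones₀ (n : ℕ) : (ones n).length = n := List.length_replicate ..

/-- `1ⁿ ⇂ m = 1^{n−m}`. [folklore] -/
private theorem drop_ones₀ (n m : ℕ) : (ones n).drop m = ones (n - m) := List.drop_replicate ..

/-- `uniformAvg 0 g = g ε`. [folklore] -/
private theorem uniformAvg_zero₀ (g : List Bool → ℝ) : uniformAvg 0 g = g [] := by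
  unfold uniformAvg
  have huniv : (Finset.univ : Finset (List.Vector Bool 0)) = {List.Vector.nil} := by
    ext v
    simp only [Finset.mem_univ, Finset.mem_singleton, true_iff]
    exact v.eq_nil
  rw [huniv, Finset.sum_singleton, pow_zero, div_one]
  rfl

/-- Linearity: `E[f − g] = E[f] − E[g]`. [folklore] -/
private theorem uniformAvg_sub₀ (m : ℕ) (f g : List Bool → ℝ) :
    uniformAvg m (fun x => f x - g x) = uniformAvg m f - uniformAvg m g := by
  unfold uniformAvg
  rw [Finset.sum_sub_distrib, sub_div]

/-- A uniform average of an `if` on a condition not depending on the variable. [folklore] -/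
private theorem uniformAvg_ite₀ (m : ℕ) (p : Prop) [Decidable p] (a : ℝ) (f : List Bool → ℝ) :
    uniformAvg m (fun x => if p then a else f x) = if p then a else uniformAvg m f := by
  split_ifs <;> simp [uniformAvg_const]

/-! ### The normalised one-step family and the doubling iterate -/

/-- **The normalised one-step family**: `os G₁ c t = G₁ ⟨c, t⟩` padded with zeros / truncated to exactly
`|t| + 1` bits. [cite: Goldreich2001, Construction 3.3.2 (G₁ : {0,1}ⁿ → {0,1}^{n+1})] -/
def os (c t : List Bool) : List Bool :=
  (G₁ (boolPair c t) ++ List.replicate (t.length + 1) false).take (t.length + 1)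

/-- `|os G₁ c t| = |t| + 1` on every string. [folklore] -/
@[simp] theorem length_os (c t : List Bool) : (os G₁ c t).length = t.length + 1 := by
  rw [os, List.length_take, List.length_append, List.length_replicate]; omega

/-- The normalisation is transparent where `G₁ ⟨c, t⟩` already has length `|t| + 1`. [folklore] -/
theorem os_eq_of_length {c t : List Bool} (h : (G₁ (boolPair c t)).length = t.length + 1) :
    os G₁ c t = G₁ (boolPair c t) := by
  rw [os, List.take_append_of_le_length h.ge, List.take_of_length_le h.le]

/-- `os G₁ c` never outputs the empty string. [folklore] -/
theorem os_ne_nil (c t : List Bool) : os G₁ c t ≠ [] := ne_nil_of_length (length_os G₁ c) t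

/-- The one-step family as a program on `z = ⟨c, t⟩`. [folklore] -/
def osP (z : List Bool) : List Bool :=
  Plumb.takeFn (boolPair (true :: sndF z) (G₁ z ++ Kannan.zerosFn (true :: sndF z)))

/-- Value of `osP`. [folklore] -/
theorem osP_boolPair (c t : List Bool) : osP G₁ (boolPair c t) = os G₁ c t := by
  simp [osP, os, Kannan.zerosFn_apply]

/-- `osP ∈ FP` for `G₁ ∈ FP`. [Arora–Barak 2009, §1.3] [folklore] -/
theorem osP_mem_FP (hG : G₁ ∈ FP) : osP G₁ ∈ FP := by
  have h : (fun z => Plumb.takeFn (boolPair (true :: sndF z) (G₁ z ++ Kannan.zerosFn (true :: sndF z)))) ∈ FP :=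
    comp_mem_FP' Plumb.takeFn_mem_FP (pair_mem_FP (comp_mem_FP' (cons_mem_FP true) sndF_mem_FP)
      (append_mem_FP hG (comp_mem_FP' Kannan.zerosFn_mem_FP (comp_mem_FP' (cons_mem_FP true) sndF_mem_FP))))
  exact h

/-- One round on `⟨acc, ⟨c, t⟩⟩`: append the first bit of `os G₁ c t`, keep its suffix and the context.
[cite: Goldreich2001, Construction 3.3.2] -/
def round₀ (z : List Bool) : List Bool :=
  boolPair (fstF z ++ take1Fn (osP G₁ (sndF z)))
    (boolPair (fstF (sndF z)) (Plumb.dropFn (boolPair [true] (osP G₁ (sndF z)))))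

/-- Value of one round. [folklore] -/
theorem round₀_boolPair (acc c t : List Bool) :
    round₀ G₁ (boolPair acc (boolPair c t)) =
      boolPair (acc ++ (os G₁ c t).take 1) (boolPair c ((os G₁ c t).drop 1)) := by
  simp [round₀, osP_boolPair, take1Fn]

/-- `round₀ ∈ FP`. [folklore] -/
theorem round₀_mem_FP (hG : G₁ ∈ FP) : round₀ G₁ ∈ FP := by
  have h : (fun z => boolPair (fstF z ++ take1Fn (osP G₁ (sndF z)))
      (boolPair (fstF (sndF z)) (Plumb.dropFn (boolPair [true] (osP G₁ (sndF z)))))) ∈ FP :=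
    pair_mem_FP (append_mem_FP fstF_mem_FP (comp_mem_FP' take1Fn_mem_FP (comp_mem_FP' (osP_mem_FP G₁ hG) sndF_mem_FP)))
      (pair_mem_FP (comp_mem_FP' fstF_mem_FP sndF_mem_FP) (comp_mem_FP' Plumb.dropFn_mem_FP
        (pair_mem_FP (const_mem_FP _) (comp_mem_FP' (osP_mem_FP G₁ hG) sndF_mem_FP))))
  exact h

/-- One round on the full state `⟨clock, ⟨acc, ⟨c, t⟩⟩⟩`, clamped to additive growth `2`. [folklore] -/
def roundF : List Bool → List Bool := clampAdd 2 (mapSndFn (round₀ G₁))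

/-- `roundF ∈ FP`. [folklore] -/
theorem roundF_mem_FP (hG : G₁ ∈ FP) : roundF G₁ ∈ FP := clampAdd_mem_FP 2 (mapSndFn_mem_FP (round₀_mem_FP G₁ hG))

/-- **Value of one clamped round** (the clamp is transparent: the state grows by exactly two symbols).
[folklore] -/
theorem roundF_state (clk acc c t : List Bool) :
    roundF G₁ (boolPair clk (boolPair acc (boolPair c t))) =
      boolPair clk (boolPair (acc ++ (os G₁ c t).take 1) (boolPair c ((os G₁ c t).drop 1))) := by
  have hval : mapSndFn (round₀ G₁) (boolPair clk (boolPair acc (boolPair c t))) =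
      boolPair clk (boolPair (acc ++ (os G₁ c t).take 1) (boolPair c ((os G₁ c t).drop 1))) := by
    rw [mapSndFn_boolPair, round₀_boolPair]
  rw [roundF, clampAdd_eq_of_le (by
    rw [hval]
    simp only [length_boolPair, List.length_append, List.length_take, List.length_drop, length_os]
    omega), hval]

/-- **`m` rounds generate `m` bits** from `⟨clk, ⟨acc, ⟨c, t⟩⟩⟩`. [cite: Goldreich2001, Construction 3.3.2] -/
theorem iterate_roundF (clk c : List Bool) : ∀ (m : ℕ) (acc t : List Bool),
    (roundF G₁)^[m] (boolPair clk (boolPair acc (boolPair c t))) =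
      boolPair clk (boolPair (acc ++ gen (os G₁ c) m t) (boolPair c (st (os G₁ c) m t))) := by
  intro m
  induction m with
  | zero => intro acc t; simp
  | succ m ih =>
    intro acc t
    rw [Function.iterate_succ_apply, roundF_state, ih, gen_succ, st_succ, List.append_assoc]

/-- The clocked loop `z ↦ roundF^{|clock z|} z`. [folklore] -/
def loopF (z : List Bool) : List Bool := (roundF G₁)^[(X : Polynomial ℕ).eval (boolUnpair z).1.length] z

/-- The clocked loop is in `FP`. [Arora–Barak 2009, §1.4.1] [cite: AroraBarakCC2009, §1.4.1] -/
theorem loopF_mem_FP (hG : G₁ ∈ FP) : loopF G₁ ∈ FP :=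
  iterate_mem_FP (roundF_mem_FP G₁ hG) 2 (length_clampAdd_le 2 _) X

/-- **Value of the loop**: `loopF ⟨clk, ⟨ε, ⟨c, t⟩⟩⟩ = ⟨clk, ⟨gen |clk| t, ⟨c, st |clk| t⟩⟩⟩`. [folklore] -/
theorem loopF_boolPair (clk c t : List Bool) :
    loopF G₁ (boolPair clk (boolPair [] (boolPair c t))) =
      boolPair clk (boolPair (gen (os G₁ c) clk.length t) (boolPair c (st (os G₁ c) clk.length t))) := by
  unfold loopF
  rw [boolUnpair_boolPair, eval_X]
  have h := iterate_roundF G₁ clk c clk.length [] t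
  rwa [List.nil_append] at h

/-- **The length-doubling iterate** `gen2 G₁ ⟨c, s⟩ = σ₁ ⋯ σ_{2|s|}` (Construction 3.3.2 with `p(n) = 2n` on the
one-step family of context `c`), as a program. [cite: Goldreich2001, Construction 3.3.2 with Thm. 3.3.3 (p(n) = 2n)]
[cite: AllenderEtAl2006, §4.1 (G^HILL_f : {0,1}ⁿ → {0,1}^{2n})] -/
def gen2 (z : List Bool) : List Bool :=
  fstF (sndF (loopF G₁ (boolPair (Plumb.polyFn (2 * X) (sndF z)) (boolPair [] z))))

/-- **Value of `gen2`.** [cite: Goldreich2001, Construction 3.3.2] -/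
theorem gen2_boolPair (c s : List Bool) : gen2 G₁ (boolPair c s) = gen (os G₁ c) (2 * s.length) s := by
  rw [gen2, sndF_boolPair, Plumb.polyFn_apply, loopF_boolPair, sndF_boolPair, fstF_boolPair, length_ones₀]
  simp

/-- **`|gen2 G₁ ⟨c, s⟩| = 2|s|`**: the family is length-doubling on every seed. [cite: Goldreich2001, Construction 3.3.2] -/
theorem length_gen2 (c s : List Bool) : (gen2 G₁ (boolPair c s)).length = 2 * s.length := by
  rw [gen2_boolPair, length_gen (os_ne_nil G₁ c)]

/-- **`gen2 ∈ FP`** for `G₁ ∈ FP`. [cite: Goldreich2001, Thm. 3.3.3 (proof: "G can be implemented in polynomial time")] -/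
theorem gen2_mem_FP (hG : G₁ ∈ FP) : gen2 G₁ ∈ FP := by
  have h : (fun z => fstF (sndF (loopF G₁ (boolPair (Plumb.polyFn (2 * X) (sndF z)) (boolPair [] z))))) ∈ FP :=
    comp_mem_FP' fstF_mem_FP (comp_mem_FP' sndF_mem_FP (comp_mem_FP' (loopF_mem_FP G₁ hG)
      (pair_mem_FP (comp_mem_FP' (Plumb.polyFn_mem_FP _) sndF_mem_FP) (pair_mem_FP (const_mem_FP []) GGM.id_mem_FP'))))
  exact h

/-! ### The preprocessing of the reduction `D'` -/

section Pre

/-- `κ(T) = |bin T|`, the number of coins read for the hybrid index. [folklore] -/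
def kap (T : ℕ) : ℕ := (encodeNat T).length

/-- `T < 2^{κ(T)}`. [folklore] -/
theorem lt_two_pow_kap (T : ℕ) : T < 2 ^ kap T := by
  have h := bitsToNat_lt (encodeNat T)
  rwa [bitsToNat_encodeNat] at h

/-- `κ(T) ≤ log₂ T + 1`. [folklore] -/
theorem kap_le_log (T : ℕ) : kap T ≤ Nat.log 2 T + 1 := TM2Pass.length_encodeNat_le T

/-- `κ(0) = 0` (`bin 0 = ε`). [folklore] -/
theorem kap_zero : kap 0 = 0 := by decide

/-- `2^{κ(T)} ≤ 2T + 1`. [folklore] -/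
theorem two_pow_kap_le (T : ℕ) : 2 ^ kap T ≤ 2 * T + 1 := by
  rcases Nat.eq_zero_or_pos T with rfl | hT
  · rw [kap_zero]; simp
  · have h1 : kap T ≤ Nat.log 2 T + 1 := kap_le_log T
    calc 2 ^ kap T ≤ 2 ^ (Nat.log 2 T + 1) := Nat.pow_le_pow_right (by norm_num) h1
      _ = 2 * 2 ^ Nat.log 2 T := by rw [pow_succ, mul_comm]
      _ ≤ 2 * T + 1 := by have := Nat.pow_log_le_self 2 hT.ne'; omega

/-- `κ(T) ≤ T`. [folklore] -/
theorem kap_le (T : ℕ) : kap T ≤ T := by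
  rcases Nat.eq_zero_or_pos T with rfl | hT
  · rw [kap_zero]
  · have h1 := kap_le_log T
    have h2 : Nat.log 2 T < T := Nat.log_lt_self 2 hT.ne'
    omega

/-- **The word handed to `M₂`** by the reduction on `⟨c, α⟩` with preprocessing coins `co`: with
`d = |α| − 1`, `T = 2d`, `κ = |bin T|`, `k = min ⟦co ↾ κ⟧ T`: if `T ≤ k` the `α`-independent dummy
`(co ⇂ κ) ↾ T`, else `((co ⇂ κ) ↾ k) · first(α) · gen_{T−k−1}(suffix(α))` (the printed `β · f_{T−k}(α)`).
[cite: Goldreich2001, Thm. 3.3.3 (proof, algorithm D')] -/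
def word (c α co : List Bool) : List Bool :=
  if 2 * (α.length - 1) ≤ min (bitsToNat (co.take (kap (2 * (α.length - 1))))) (2 * (α.length - 1)) then
    (co.drop (kap (2 * (α.length - 1)))).take (2 * (α.length - 1))
  else
    (co.drop (kap (2 * (α.length - 1)))).take
        (min (bitsToNat (co.take (kap (2 * (α.length - 1))))) (2 * (α.length - 1))) ++
      (α.take 1 ++ gen (os G₁ c) (2 * (α.length - 1) -
        min (bitsToNat (co.take (kap (2 * (α.length - 1))))) (2 * (α.length - 1)) - 1) (α.drop 1))

/-- `word` with its abbreviations named. [folklore] -/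
theorem word_eq (c α co : List Bool) {d T κ k : ℕ} (hd : α.length - 1 = d) (hT : 2 * d = T)
    (hκ : kap T = κ) (hk : min (bitsToNat (co.take κ)) T = k) :
    word G₁ c α co =
      if T ≤ k then (co.drop κ).take T
      else (co.drop κ).take k ++ (α.take 1 ++ gen (os G₁ c) (T - k - 1) (α.drop 1)) := by
  subst hd; subst hT; subst hκ; subst hk; rfl

/-- `first(G s) · gen_j(suffix(G s)) = gen_{j+1}(s)` (Construction 3.3.2, one step). [cite: Goldreich2001, Construction 3.3.2] -/
theorem take_one_append_gen (G : List Bool → List Bool) (j : ℕ) (s : List Bool) :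
    (G s).take 1 ++ gen G j ((G s).drop 1) = gen G (j + 1) s := (gen_succ G j s).symm

variable {G₁}

/-- The context `c`. [folklore] -/
private def cF (Z : List Bool) : List Bool := fstF (fstF Z)
/-- The challenge `α`. [folklore] -/
private def aF (Z : List Bool) : List Bool := sndF (fstF Z)
/-- `suffix(α)`. [folklore] -/
private def atF (Z : List Bool) : List Bool := Plumb.dropFn (boolPair [true] (aF Z))
/-- `1^T`, `T = 2(|α| − 1)`. [folklore] -/
private def TU (Z : List Bool) : List Bool := Plumb.polyFn (2 * X) (atF Z)
/-- `1^κ`. [folklore] -/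
private def kU₀ (Z : List Bool) : List Bool := Plumb.polyFn X (lenBinF (TU Z))
/-- The index coins `co ↾ κ`. [folklore] -/
private def c1F (Z : List Bool) : List Bool := Plumb.takeFn (boolPair (kU₀ Z) (sndF Z))
/-- The remaining coins `co ⇂ κ`. [folklore] -/
private def c2F (Z : List Bool) : List Bool := Plumb.dropFn (boolPair (kU₀ Z) (sndF Z))
/-- `1^k`, `k = min ⟦co ↾ κ⟧ T`. [folklore] -/
private def kU (Z : List Bool) : List Bool := binToUnaryFn (boolPair (TU Z) (c1F Z))
/-- The test `T ≤ k` (one bit). [folklore] -/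
private def condF (Z : List Bool) : List Bool := lenLeFn X (boolPair (kU Z) (TU Z))
/-- `β = (co ⇂ κ) ↾ k`. [folklore] -/
private def rhoF (Z : List Bool) : List Bool := Plumb.takeFn (boolPair (kU Z) (c2F Z))
/-- The loop count `1^{T − k − 1}`. [folklore] -/
private def cntF (Z : List Bool) : List Bool := Plumb.dropFn (boolPair (true :: kU Z) (TU Z))
/-- The generated suffix `gen_{T−k−1}(suffix(α))`. [folklore] -/
private def genF (G₁ : List Bool → List Bool) (Z : List Bool) : List Bool :=
  fstF (sndF (loopF G₁ (boolPair (cntF Z) (boolPair [] (boolPair (cF Z) (atF Z))))))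
/-- The hybrid word `β · first(α) · gen_{T−k−1}(suffix(α))`. [folklore] -/
private def hybW (G₁ : List Bool → List Bool) (Z : List Bool) : List Bool := rhoF Z ++ (take1Fn (aF Z) ++ genF G₁ Z)
/-- The dummy word `(co ⇂ κ) ↾ T`. [folklore] -/
private def dumW (Z : List Bool) : List Bool := Plumb.takeFn (boolPair (TU Z) (c2F Z))

variable (G₁)

/-- **The preprocessing of `D'`**: `⟨⟨c, α⟩, co⟩ ↦ ⟨c, word c α co⟩` as a pipeline of `FP` bricks.
[cite: Goldreich2001, Thm. 3.3.3 (proof, algorithm D')] -/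
def pre (Z : List Bool) : List Bool := boolPair (cF Z) (iteFn condF dumW (hybW G₁) Z)

/-- `pre ∈ FP` for `G₁ ∈ FP`. [Arora–Barak 2009, §1.3–1.4] [cite: AroraBarakCC2009, §1.3] -/
theorem pre_mem_FP (hG : G₁ ∈ FP) : pre G₁ ∈ FP := by
  have hc : cF ∈ FP := (comp_mem_FP' fstF_mem_FP fstF_mem_FP :)
  have ha : aF ∈ FP := (comp_mem_FP' sndF_mem_FP fstF_mem_FP :)
  have hat : atF ∈ FP := (comp_mem_FP' Plumb.dropFn_mem_FP (pair_mem_FP (const_mem_FP _) ha) :)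
  have hT : TU ∈ FP := (comp_mem_FP' (Plumb.polyFn_mem_FP _) hat :)
  have hk₀ : kU₀ ∈ FP := (comp_mem_FP' (Plumb.polyFn_mem_FP _) (comp_mem_FP' lenBinF_mem_FP hT) :)
  have hc1 : c1F ∈ FP := (comp_mem_FP' Plumb.takeFn_mem_FP (pair_mem_FP hk₀ sndF_mem_FP) :)
  have hc2 : c2F ∈ FP := (comp_mem_FP' Plumb.dropFn_mem_FP (pair_mem_FP hk₀ sndF_mem_FP) :)
  have hk : kU ∈ FP := (comp_mem_FP' binToUnaryFn_mem_FP (pair_mem_FP hT hc1) :)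
  have hcond : condF ∈ FP := (comp_mem_FP' (lenLeFn_mem_FP X) (pair_mem_FP hk hT) :)
  have hrho : rhoF ∈ FP := (comp_mem_FP' Plumb.takeFn_mem_FP (pair_mem_FP hk hc2) :)
  have hcnt : cntF ∈ FP := (comp_mem_FP' Plumb.dropFn_mem_FP (pair_mem_FP (comp_mem_FP' (cons_mem_FP true) hk) hT) :)
  have hgen : genF G₁ ∈ FP := (comp_mem_FP' fstF_mem_FP (comp_mem_FP' sndF_mem_FP (comp_mem_FP' (loopF_mem_FP G₁ hG)
    (pair_mem_FP hcnt (pair_mem_FP (const_mem_FP []) (pair_mem_FP hc hat))))) :)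
  have hhyb : hybW G₁ ∈ FP := (append_mem_FP hrho (append_mem_FP (comp_mem_FP' take1Fn_mem_FP ha) hgen) :)
  have hdum : dumW ∈ FP := (comp_mem_FP' Plumb.takeFn_mem_FP (pair_mem_FP hT hc2) :)
  exact (pair_mem_FP hc (iteFn_mem_FP hcond hdum hhyb) :)

/-- **Value of the preprocessing** on every machine input `⟨⟨c, α⟩, co⟩`. [cite: Goldreich2001, Thm. 3.3.3 (proof, algorithm D')] -/
theorem pre_boolPair (c α co : List Bool) :
    pre G₁ (boolPair (boolPair c α) co) = boolPair c (word G₁ c α co) := by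
  obtain ⟨d, hd⟩ : ∃ d, α.length - 1 = d := ⟨_, rfl⟩
  obtain ⟨T, hT⟩ : ∃ T, 2 * d = T := ⟨_, rfl⟩
  obtain ⟨κ, hκ⟩ : ∃ κ, kap T = κ := ⟨_, rfl⟩
  obtain ⟨k, hk⟩ : ∃ k, min (bitsToNat (co.take κ)) T = k := ⟨_, rfl⟩
  rw [word_eq G₁ c α co hd hT hκ hk]
  have vc : cF (boolPair (boolPair c α) co) = c := by simp [cF]
  have va : aF (boolPair (boolPair c α) co) = α := by simp [aF]
  have vat : atF (boolPair (boolPair c α) co) = α.drop 1 := by simp [atF, va]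
  have vT : TU (boolPair (boolPair c α) co) = ones T := by
    rw [TU, vat, Plumb.polyFn_apply, List.length_drop, hd]
    simp [hT]
  have vk₀ : kU₀ (boolPair (boolPair c α) co) = ones κ := by
    rw [kU₀, vT, lenBinF_apply, Plumb.polyFn_apply, length_ones₀, eval_X]
    exact congrArg ones hκ
  have vc1 : c1F (boolPair (boolPair c α) co) = co.take κ := by
    rw [c1F, vk₀, sndF_boolPair, Plumb.takeFn_boolPair, length_ones₀]
  have vc2 : c2F (boolPair (boolPair c α) co) = co.drop κ := by
    rw [c2F, vk₀, sndF_boolPair, Plumb.dropFn_boolPair, length_ones₀]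
  have vk : kU (boolPair (boolPair c α) co) = ones k := by
    rw [kU, vT, vc1, binToUnaryFn_boolPair, length_ones₀, hk]
  have vcond : condF (boolPair (boolPair c α) co) = [decide (T ≤ k)] := by
    rw [condF, vk, vT, lenLeFn_boolPair, length_ones₀, length_ones₀, eval_X]
  have vrho : rhoF (boolPair (boolPair c α) co) = (co.drop κ).take k := by
    rw [rhoF, vk, vc2, Plumb.takeFn_boolPair, length_ones₀]
  have vcnt : cntF (boolPair (boolPair c α) co) = ones (T - k - 1) := by
    rw [cntF, vk, vT, Plumb.dropFn_boolPair, List.length_cons, length_ones₀, drop_ones₀, Nat.sub_sub]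
  have vgen : genF G₁ (boolPair (boolPair c α) co) = gen (os G₁ c) (T - k - 1) (α.drop 1) := by
    rw [genF, vcnt, vc, vat, loopF_boolPair, sndF_boolPair, fstF_boolPair, length_ones₀]
  have vhyb : hybW G₁ (boolPair (boolPair c α) co) =
      (co.drop κ).take k ++ (α.take 1 ++ gen (os G₁ c) (T - k - 1) (α.drop 1)) := by
    rw [hybW, vrho, va, vgen]; rfl
  have vdum : dumW (boolPair (boolPair c α) co) = (co.drop κ).take T := by
    rw [dumW, vT, vc2, Plumb.takeFn_boolPair, length_ones₀]
  rw [pre, vc, iteFn_apply vcond]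
  by_cases hle : T ≤ k
  · rw [if_pos (decide_eq_true hle), vdum, if_pos hle]
  · rw [decide_eq_false hle, vhyb, if_neg hle]
    rfl

end Pre

/-! ### Acceptance probabilities and the hybrids -/

/-- `acc M O c w = Pr[M^O⟨c, w⟩ = 1]` (over `M`'s coins; a run without output counts as not `1`).
[cite: Goldreich2001, §3.6 Def. 3.6.4 (Pr[M^F(·) = 1])] -/
def acc (M : OracleAdversary Bool) (O : Oracle) (c w : List Bool) : ℝ :=
  ((M.outputPMF O (boolPair c w)) (some true)).toReal

/-- Unfolding of `acc`. [folklore] -/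
theorem acc_apply (M : OracleAdversary Bool) (O : Oracle) (c w : List Bool) :
    acc M O c w = ((M.outputPMF O (boolPair c w)) (some true)).toReal := rfl

/-- `p_k = E_{β←U_k} E_{t←U_d} Pr[M₂^O⟨c, β · gen_{T−k}(t)⟩ = 1]`: the acceptance probability of `M₂` on
the hybrid `H^k`. [cite: Goldreich2001, Thm. 3.3.3 (proof: the hybrids H^k_n and d^k(n))] -/
def pHyb (M₂ : OracleAdversary Bool) (O : Oracle) (c : List Bool) (d T k : ℕ) : ℝ :=
  uniformAvg k (fun β => uniformAvg d (fun t => acc M₂ O c (β ++ gen (os G₁ c) (T - k) t)))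

variable {G₁}

/-- **`H^0` is the generator's output**: `p_0 = E_{s←U_d} Pr[M₂^O⟨c, gen2 ⟨c, s⟩⟩ = 1]` for `T = 2d`.
[cite: Goldreich2001, Thm. 3.3.3 (proof: "H^0_n equals G(U_n)")] -/
theorem pHyb_zero (M₂ : OracleAdversary Bool) (O : Oracle) (c : List Bool) (d : ℕ) :
    pHyb G₁ M₂ O c d (2 * d) 0 = uniformAvg d (fun s => acc M₂ O c (gen2 G₁ (boolPair c s))) := by
  rw [pHyb, uniformAvg_zero₀]
  refine uniformAvg_congr fun s hs => ?_
  rw [List.nil_append, Nat.sub_zero, gen2_boolPair, hs]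

/-- **`H^T` is uniform**: `p_T = E_{w←U_T} Pr[M₂^O⟨c, w⟩ = 1]`. [cite: Goldreich2001, Thm. 3.3.3 (proof: "H^{p(n)}_n equals U_{p(n)}")] -/
theorem pHyb_self (M₂ : OracleAdversary Bool) (O : Oracle) (c : List Bool) (d T : ℕ) :
    pHyb G₁ M₂ O c d T T = uniformAvg T (fun w => acc M₂ O c w) := by
  rw [pHyb]
  refine uniformAvg_congr fun β _ => ?_
  simp only [Nat.sub_self, gen_zero, List.append_nil]
  exact uniformAvg_const _ _

/-- **Reindexing a uniform average by the value of the string**: for `h : ℕ → ℝ`,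
`E_{v←U_κ} h(⟦v⟧) = 2^{−κ} ∑_{m<2^κ} h(m)` (`⟦·⟧` is a bijection `{0,1}^κ ≃ [0, 2^κ)`, `BitCodec.finPow`). [folklore] -/
theorem uniformAvg_bitsToNat (κ : ℕ) (h : ℕ → ℝ) :
    uniformAvg κ (fun v => h (bitsToNat v)) = (∑ m ∈ range (2 ^ κ), h m) / 2 ^ κ := by
  unfold uniformAvg
  congr 1
  have h1 := BitCodec.sum_vector_eq (BitCodec.finPow κ) (fun v => h (bitsToNat v))
  rw [BitCodec.finPow_len] at h1
  rw [h1]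
  simp_rw [BitCodec.bitsToNat_finPow_enc]
  exact Fin.sum_univ_eq_sum_range (fun m => h m) (2 ^ κ)

/-- The summand of the telescoping sum: `0` past `T`, else `P(m+1) − P(m)`. [folklore] -/
private def hstep (P : ℕ → ℝ) (T m : ℕ) : ℝ := if T ≤ m then 0 else P (m + 1) - P m

/-- **The telescoping average**: with `k = min ⟦c₁⟧ T`, `c₁ ← U_κ`, `T ≤ 2^κ`, the average of
`[k < T] · (P(k+1) − P(k))` is `(P(T) − P(0)) / 2^κ`. [cite: Goldreich2001, Thm. 3.3.3 (proof: the telescoping sum)] -/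
private theorem telescope (κ T : ℕ) (hT : T ≤ 2 ^ κ) (P : ℕ → ℝ) (E : ℝ) :
    uniformAvg κ (fun c₁ : List Bool =>
      (if T ≤ min (bitsToNat c₁) T then E else P (min (bitsToNat c₁) T + 1)) -
        (if T ≤ min (bitsToNat c₁) T then E else P (min (bitsToNat c₁) T))) = (P T - P 0) / 2 ^ κ := by
  have hfun : (fun c₁ : List Bool =>
      (if T ≤ min (bitsToNat c₁) T then E else P (min (bitsToNat c₁) T + 1)) -
        (if T ≤ min (bitsToNat c₁) T then E else P (min (bitsToNat c₁) T))) =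
      fun c₁ => hstep P T (bitsToNat c₁) := by
    funext c₁
    by_cases hm : T ≤ bitsToNat c₁
    · simp only [min_eq_right hm, if_pos le_rfl, hstep, if_pos hm, sub_self]
    · simp only [min_eq_left (not_le.1 hm).le, if_neg hm, hstep]
  rw [hfun, uniformAvg_bitsToNat κ (hstep P T)]
  congr 1
  rw [← Finset.sum_range_add_sum_Ico _ hT]
  have hzero : ∑ m ∈ Finset.Ico T (2 ^ κ), hstep P T m = 0 :=
    Finset.sum_eq_zero fun m hm => by rw [hstep, if_pos (Finset.mem_Ico.1 hm).1]
  rw [hzero, add_zero]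
  have hsum : ∑ m ∈ range T, hstep P T m = ∑ m ∈ range T, (P (m + 1) - P m) :=
    Finset.sum_congr rfl fun m hm => by rw [hstep, if_neg (not_le.2 (Finset.mem_range.1 hm))]
  rw [hsum, Finset.sum_range_sub]

/-! ### The laws of the reduction (Claims 3.3.3.1–2 as uniform averages) -/

section Laws

variable (G₁) (M₂ : OracleAdversary Bool) (O : Oracle) (c : List Bool) (d K : ℕ)

/-- The dummy term `E_{c₂} Pr[M₂^O⟨c, c₂ ↾ T⟩ = 1]` (the same in both worlds). [folklore] -/
private def dum : ℝ := uniformAvg (K - kap (2 * d)) (fun c₂ => acc M₂ O c (c₂.take (2 * d)))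

/-- **Gen side, inner average**: for a challenge `α` with `|α| = d + 1`, `first(α) · gen_{T−k−1}(suffix α) =: g`,
the average over the preprocessing coins of `Pr[M₂ accepts the word]` splits over the index coins.
[cite: Goldreich2001, Thm. 3.3.3 (proof, Claim 3.3.3.2)] -/
private theorem inner_eq (hK : kap (2 * d) + 2 * d ≤ K) {α : List Bool} (hα : α.length = d + 1) :
    uniformAvg K (fun co => acc M₂ O c (word G₁ c α co)) =
      uniformAvg (kap (2 * d)) (fun c₁ =>
        if 2 * d ≤ min (bitsToNat c₁) (2 * d) then dum M₂ O c d K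
        else uniformAvg (min (bitsToNat c₁) (2 * d)) (fun β =>
          acc M₂ O c (β ++ (α.take 1 ++ gen (os G₁ c) (2 * d - min (bitsToNat c₁) (2 * d) - 1) (α.drop 1))))) := by
  obtain ⟨e, he⟩ : ∃ e, K = kap (2 * d) + e := ⟨K - kap (2 * d), by omega⟩
  rw [he, uniformAvg_append (kap (2 * d)) e]
  refine uniformAvg_congr fun c₁ hc₁ => ?_
  have hd : α.length - 1 = d := by omega
  have hword : ∀ c₂ : List Bool, word G₁ c α (c₁ ++ c₂) =
      if 2 * d ≤ min (bitsToNat c₁) (2 * d) then c₂.take (2 * d)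
      else c₂.take (min (bitsToNat c₁) (2 * d)) ++
        (α.take 1 ++ gen (os G₁ c) (2 * d - min (bitsToNat c₁) (2 * d) - 1) (α.drop 1)) := by
    intro c₂
    rw [word_eq G₁ c α (c₁ ++ c₂) hd rfl rfl (k := min (bitsToNat c₁) (2 * d))
      (by rw [List.take_append_of_le_length hc₁.ge, List.take_of_length_le hc₁.le]),
      List.drop_append_of_le_length hc₁.ge, List.drop_of_length_le hc₁.le, List.nil_append]
  simp_rw [hword]
  by_cases hle : 2 * d ≤ min (bitsToNat c₁) (2 * d)
  · simp only [if_pos hle, dum, Nat.add_sub_cancel_left]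
  · simp only [if_neg hle]
    have hke : min (bitsToNat c₁) (2 * d) ≤ e := by have := min_le_right (bitsToNat c₁) (2 * d); omega
    obtain ⟨e', he'⟩ : ∃ e', e = min (bitsToNat c₁) (2 * d) + e' := ⟨e - min (bitsToNat c₁) (2 * d), by omega⟩
    rw [he']
    exact uniformAvg_take (min (bitsToNat c₁) (2 * d)) e' (fun β =>
      acc M₂ O c (β ++ (α.take 1 ++ gen (os G₁ c) (2 * d - min (bitsToNat c₁) (2 * d) - 1) (α.drop 1))))

/-- **Claim 3.3.3.1–2, pseudorandom side**: on `α = os G₁ c t`, `t ← U_d`, the reduction's acceptance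
probability is `E_{c₁}[if T ≤ k then dummy else p_k]`. [cite: Goldreich2001, Thm. 3.3.3 (proof, Claims 3.3.3.1–2)] -/
private theorem law_gen (hK : kap (2 * d) + 2 * d ≤ K) :
    uniformAvg d (fun t => uniformAvg K (fun co => acc M₂ O c (word G₁ c (os G₁ c t) co))) =
      uniformAvg (kap (2 * d)) (fun c₁ =>
        if 2 * d ≤ min (bitsToNat c₁) (2 * d) then dum M₂ O c d K
        else pHyb G₁ M₂ O c d (2 * d) (min (bitsToNat c₁) (2 * d))) := by
  have h1 : uniformAvg d (fun t => uniformAvg K (fun co => acc M₂ O c (word G₁ c (os G₁ c t) co))) =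
      uniformAvg d (fun t => uniformAvg (kap (2 * d)) (fun c₁ =>
        if 2 * d ≤ min (bitsToNat c₁) (2 * d) then dum M₂ O c d K
        else uniformAvg (min (bitsToNat c₁) (2 * d)) (fun β =>
          acc M₂ O c (β ++ gen (os G₁ c) (2 * d - min (bitsToNat c₁) (2 * d)) t)))) := by
    refine uniformAvg_congr fun t ht => ?_
    rw [inner_eq G₁ M₂ O c d K hK (by rw [length_os, ht])]
    refine uniformAvg_congr fun c₁ _ => ?_
    split_ifs with hle
    · rfl
    · refine uniformAvg_congr fun β _ => ?_
      have hsucc : 2 * d - min (bitsToNat c₁) (2 * d) = (2 * d - min (bitsToNat c₁) (2 * d) - 1) + 1 := by omega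
      rw [take_one_append_gen, ← hsucc]
  rw [h1, uniformAvg_comm]
  refine uniformAvg_congr fun c₁ _ => ?_
  rw [uniformAvg_ite₀]
  split_ifs with hle
  · rfl
  · rw [pHyb, uniformAvg_comm]

/-- **Claim 3.3.3.1–2, uniform side**: on `α ← U_{d+1}` the reduction's acceptance probability is
`E_{c₁}[if T ≤ k then dummy else p_{k+1}]` (`U_k · U_1 ≡ U_{k+1}`, the suffix of a uniform string is a fresh
uniform seed). [cite: Goldreich2001, Thm. 3.3.3 (proof, Claims 3.3.3.1–2)] -/
private theorem law_uniform (hK : kap (2 * d) + 2 * d ≤ K) :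
    uniformAvg (d + 1) (fun α => uniformAvg K (fun co => acc M₂ O c (word G₁ c α co))) =
      uniformAvg (kap (2 * d)) (fun c₁ =>
        if 2 * d ≤ min (bitsToNat c₁) (2 * d) then dum M₂ O c d K
        else pHyb G₁ M₂ O c d (2 * d) (min (bitsToNat c₁) (2 * d) + 1)) := by
  -- split `α = b · t`, `|b| = 1`
  rw [Nat.add_comm d 1, uniformAvg_append 1 d]
  have h1 : uniformAvg 1 (fun b => uniformAvg d (fun t => uniformAvg K (fun co => acc M₂ O c (word G₁ c (b ++ t) co)))) =
      uniformAvg 1 (fun b => uniformAvg d (fun t => uniformAvg (kap (2 * d)) (fun c₁ =>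
        if 2 * d ≤ min (bitsToNat c₁) (2 * d) then dum M₂ O c d K
        else uniformAvg (min (bitsToNat c₁) (2 * d)) (fun β =>
          acc M₂ O c ((β ++ b) ++ gen (os G₁ c) (2 * d - (min (bitsToNat c₁) (2 * d) + 1)) t))))) := by
    refine uniformAvg_congr fun b hb => uniformAvg_congr fun t ht => ?_
    rw [inner_eq G₁ M₂ O c d K hK (by rw [List.length_append, hb, ht, Nat.add_comm])]
    refine uniformAvg_congr fun c₁ _ => ?_
    split_ifs with hle
    · rfl
    · refine uniformAvg_congr fun β _ => ?_
      rw [List.take_append_of_le_length hb.ge, List.take_of_length_le hb.le,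
        List.drop_append_of_le_length hb.ge, List.drop_of_length_le hb.le, List.nil_append,
        List.append_assoc, Nat.sub_sub]
  rw [h1]
  -- move the averages over `b` and `t` inside
  have h2 : ∀ b : List Bool,
      uniformAvg d (fun t => uniformAvg (kap (2 * d)) (fun c₁ =>
        if 2 * d ≤ min (bitsToNat c₁) (2 * d) then dum M₂ O c d K
        else uniformAvg (min (bitsToNat c₁) (2 * d)) (fun β =>
          acc M₂ O c ((β ++ b) ++ gen (os G₁ c) (2 * d - (min (bitsToNat c₁) (2 * d) + 1)) t)))) =
      uniformAvg (kap (2 * d)) (fun c₁ =>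
        if 2 * d ≤ min (bitsToNat c₁) (2 * d) then dum M₂ O c d K
        else uniformAvg (min (bitsToNat c₁) (2 * d)) (fun β => uniformAvg d (fun t =>
          acc M₂ O c ((β ++ b) ++ gen (os G₁ c) (2 * d - (min (bitsToNat c₁) (2 * d) + 1)) t)))) := by
    intro b
    rw [uniformAvg_comm]
    refine uniformAvg_congr fun c₁ _ => ?_
    rw [uniformAvg_ite₀]
    split_ifs with hle
    · rfl
    · rw [uniformAvg_comm]
  simp_rw [h2]
  rw [uniformAvg_comm]
  refine uniformAvg_congr fun c₁ _ => ?_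
  rw [uniformAvg_ite₀]
  split_ifs with hle
  · rfl
  · rw [uniformAvg_comm, pHyb, uniformAvg_append (min (bitsToNat c₁) (2 * d)) 1]

/-- **The telescoping identity**: `(uniform side) − (gen side) = (p_T − p_0) / 2^κ`.
[cite: Goldreich2001, Thm. 3.3.3 (proof: the telescoping sum over the hybrids)] -/
private theorem law_sub (hK : kap (2 * d) + 2 * d ≤ K) :
    uniformAvg (d + 1) (fun α => uniformAvg K (fun co => acc M₂ O c (word G₁ c α co))) -
        uniformAvg d (fun t => uniformAvg K (fun co => acc M₂ O c (word G₁ c (os G₁ c t) co))) =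
      (pHyb G₁ M₂ O c d (2 * d) (2 * d) - pHyb G₁ M₂ O c d (2 * d) 0) / 2 ^ kap (2 * d) := by
  rw [law_uniform G₁ M₂ O c d K hK, law_gen G₁ M₂ O c d K hK, ← uniformAvg_sub₀]
  exact telescope (kap (2 * d)) (2 * d) (lt_two_pow_kap (2 * d)).le (pHyb G₁ M₂ O c d (2 * d)) (dum M₂ O c d K)

end Laws

/-! ### The one-step distinguisher -/

/-- **The relativised, exact, per-length hybrid reduction of Thm. 3.3.3 with a public context.** For every
one-step family `G₁ ∈ FP` (read as `t ↦ G₁ ⟨c, t⟩`, normalised to `os G₁ c`) and every PPT oracle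
adversary `M₂` there is a PPT oracle adversary `M₁` — "pick `k < 2d` and `β ← U_k` at random, run `M₂`
on `⟨c, β · first(α) · gen_{2d−k−1}(suffix α)⟩`", forwarding `M₂`'s oracle queries — such that for EVERY
deterministic oracle `O`, context `c` and seed length `d`:
`Pr_{α←U_{d+1}}[M₁^O⟨c,α⟩ = 1] − Pr_{t←U_d}[M₁^O⟨c, os G₁ c t⟩ = 1]
   = (Pr_{w←U_{2d}}[M₂^O⟨c,w⟩ = 1] − Pr_{s←U_d}[M₂^O⟨c, gen2 G₁ ⟨c,s⟩⟩ = 1]) / 2^{κ(2d)}`,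
with `2^{κ(2d)} ≤ 4d + 1` (`two_pow_kap_le`): a distinguisher for the doubling iterate with one-sided
advantage `δ` at seed length `d` yields a distinguisher for one step with one-sided advantage
`≥ δ/(4d+1)` at the same `d`, the same context and the same oracle.
[cite: Goldreich2001, Thm. 3.3.3 (proof: algorithm D', Claims 3.3.3.1–2, the telescoping sum), PDF pp. 146–148]
[cite: HastadImpagliazzoLevinLuby1999, Prop. 3.3.4 with Def. 3.6.1 (oracle-TM reductions, level-wise) and §3.1 (public input)] -/
theorem exists_oneStep_distinguisher (hG : G₁ ∈ FP) (M₂ : OracleAdversary Bool)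
    (hM₂ : M₂.IsPPT encodingBoolBool) :
    ∃ M₁ : OracleAdversary Bool, M₁.IsPPT encodingBoolBool ∧
      ∀ (O : Oracle) (c : List Bool) (d : ℕ),
        uniformAvg (d + 1) (fun α => ((M₁.outputPMF O (boolPair c α)) (some true)).toReal) -
            uniformAvg d (fun t => ((M₁.outputPMF O (boolPair c (os G₁ c t))) (some true)).toReal) =
          (uniformAvg (2 * d) (fun w => ((M₂.outputPMF O (boolPair c w)) (some true)).toReal) -
              uniformAvg d (fun s => ((M₂.outputPMF O (boolPair c (gen2 G₁ (boolPair c s)))) (some true)).toReal)) /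
            2 ^ kap (2 * d) := by
  obtain ⟨M₁, hM₁, -, hlaw⟩ := M₂.exists_ppt_outputPMF_rprecomp hM₂ (pre_mem_FP G₁ hG) (4 * X)
  refine ⟨M₁, hM₁, fun O c d => ?_⟩
  -- the preprocessing coin count on inputs `⟨c, α⟩`, `|α| = d + 1`
  set K : ℕ := (4 * X : Polynomial ℕ).eval (boolPair c (ones (d + 1))).length with hK
  have hKα : ∀ α : List Bool, α.length = d + 1 → (4 * X : Polynomial ℕ).eval (boolPair c α).length = K := by
    intro α hα
    simp only [hK, length_boolPair, hα, length_ones₀]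
  have hKge : kap (2 * d) + 2 * d ≤ K := by
    have h1 := kap_le (2 * d)
    simp only [hK, eval_mul, eval_ofNat, eval_X, length_boolPair, length_ones₀]
    omega
  -- the acceptance probability of `M₁` on `⟨c, α⟩` as an average over the preprocessing coins
  have hacc : ∀ α : List Bool, α.length = d + 1 →
      ((M₁.outputPMF O (boolPair c α)) (some true)).toReal =
        uniformAvg K (fun co => acc M₂ O c (word G₁ c α co)) := by
    intro α hα
    have h := hlaw O (boolPair c α) {some true}
    rw [PMF.toOuterMeasure_apply_singleton, hKα α hα] at h
    rw [h]
    refine uniformAvg_congr fun co _ => ?_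
    rw [pre_boolPair, PMF.toOuterMeasure_apply_singleton, acc_apply]
  have hU : uniformAvg (d + 1) (fun α => ((M₁.outputPMF O (boolPair c α)) (some true)).toReal) =
      uniformAvg (d + 1) (fun α => uniformAvg K (fun co => acc M₂ O c (word G₁ c α co))) :=
    uniformAvg_congr fun α hα => hacc α hα
  have hGside : uniformAvg d (fun t => ((M₁.outputPMF O (boolPair c (os G₁ c t))) (some true)).toReal) =
      uniformAvg d (fun t => uniformAvg K (fun co => acc M₂ O c (word G₁ c (os G₁ c t) co))) :=
    uniformAvg_congr fun t ht => hacc _ (by rw [length_os, ht])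
  rw [hU, hGside, law_sub G₁ M₂ O c d K hKge, pHyb_self, pHyb_zero]
  rfl

end OStretch

end Literature.Computability.Cryptography

end
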